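import Summits.BirchSwinnertonDyer.BirchSwinnertonDyer.Theorems.SmallImageMuTransferMuTransferX9StepTwoElement
import Summits.BirchSwinnertonDyer.BirchSwinnertonDyer.Theorems.AlignedTransportAtTwoMainConjectureOfRankZeroBSDAtTwoFineRoadKleinCohomology
import Literature.NumberTheory.GaloisRepresentations.ContinuousH1TrivialRestriction
import HarnessLib

/-!
# Route ByReductionTypeAtTwo, crux `OrdKatoHalfAtTwoIso` (stmt-BirchSwinnertonDyer-19573), line
# `steinberg-fibre-at-two`: PORT ENGINES (pure algebra) for `stub_port` at `p = 2`

Seat `cruxlead-stmt-BirchSwinnertonDyer-19573-g0` (LEAD PROVER, MODE LINE), helper W2a.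
HONEST FRAMING (cell bsd-2adic): BSD is not proved; the crux `OrdKatoHalfAtTwoIso` is not proved; `stub_port`
is not proved here. This file is PURE ALGEBRA (linear algebra over a field, continuous 1-cocycles of a
topological group, a Klein four-group with a fixed-point-free automorphism, additive endomorphisms of a
`p`-torsion group); no elliptic curve occurs in it. `--supports stmt-BirchSwinnertonDyer-19573 --as helper`.

WHY. The odd-prime kernel core `X10.coreTheoremAOddPrime_holds` is being ported to `p = 2` on the DD12 residue
(`ρ̄_{E,2}` onto `GL₂(𝔽₂) ≅ S₃`, `Δ < 0`). The port needs five characteristic-free replacements of odd-prime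
devices; they are proved here, in the namespaces of their odd-prime twins:

* **E1** `LevelE.exists_mem_pairingCoeff_le_two_ne_zero` — the level-`2` polarisation replacing KOLY 5.7.B
  (`LevelE.exists_mem_pairingCoeff_ne_zero (h2 : (2 : k) ≠ 0)`, the only `2⁻¹` of Step 1,
  `…X9CoreStepOne`): with the `T²`-coefficients `(Tx)₂ = x₁`, `(Dy)₂ = y₀ − y₁` a `(T, D)`-stable submodule
  whose two slot-`0` projections are onto has a member with a non-zero pairing coefficient `c₀`, `c₁` or `c₂`,
  in EVERY characteristic.
* **E2** `JointValue.exists_mem_map_eq_one_apply_eq_of_cubic` / `…map_eq_apply_eq_of_cubic` — the CUBIC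
  joint-value engine replacing the central scalar (`JointValue.exists_mem_map_eq_one_apply_eq`): for `z` with
  `z (z − 1) = 1` on `X` and `Y` and any `χ` centralising `z`, every joint value of `(φ, ψ)` on `H` is the joint
  value of some `ν ∈ H ∩ ker χ`, namely `ν = z (z τ z⁻¹ τ⁻¹) z⁻¹`.
* **H3** `AtTwo.smul_smul_sub_eq_self_of_fpf` — Klein rigidity: a fixed-point-free `z` on the Klein four-group
  satisfies `z (z m − m) = m` (feeds `hzX` / `hzY` of E2).
* **H4** `AtTwo.iterate_sub_id_eq_zero_of_prime_pow` (every prime) and `AtTwo.iterate_sub_id_eq_zero_of_pow_two`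
  (`p = 2`) — unipotent ⟹ nilpotent on a `p`-torsion group WITHOUT `p ≠ 2` (the `hG1` arithmetic of the
  Selmer side; odd twin `SelmerDual.iterate_conj_sub_id_eq_zero_of_pow (hp2 : p ≠ 2)`): in `End(V)`,
  `g^{pⁿ} = ((g − 1) + 1)^{pⁿ} = (g − 1)^{pⁿ} + 1 + p (g − 1) r`.
* **H5** `AtTwo.sum_range_natCast_zsmul_eq_zero_of_four_dvd` — the binomial site of the Kolyvagin derivative
  (`C(ℓ − 1, 2) · t = 0`; odd twin `sum_range_natCast_zsmul_eq_zero (hp2) (hn : p ∣ n)`): on a `2`-torsion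
  module `(Σ_{i<n} i) • x = 0` as soon as `4 ∣ n` (Gauss), so the Kolyvagin prime must have `ℓ ≡ 1 (mod 4)`.

Credit: statements and the proofs of E1, E2, H3 are adapted from the ideator's scratch file
`sidea-stub_port-1/StubPortHelpersAtTwo.lean` (STUB-IDEAS-stub_port-1 @82c64e14eec0e2be, §0/§5).

References: J.-P. Serre, *Corps locaux* (1979) VII §5 Prop. 3; J.-P. Serre, Invent. Math. 15 (1972) §5.3;
K. Rubin, *Euler Systems* (2000) §4.4; the tree's `…X9StepTwoElement.lean` §1, `…X9SelmerDualLocalFineNil.lean`,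
`…X9KolyvaginClassTwistRat.lean` §3.
-/

set_option autoImplicit false
set_option linter.dupNamespace false

noncomputable section

open Function Finset
open Literature.NumberTheory.GaloisRepresentations

namespace Summit.BirchSwinnertonDyer.BirchSwinnertonDyer.Rank1Residual

/-! ## E1  The level-`2` polarisation (characteristic-free KOLY 5.7.B) -/

namespace LevelE

variable {k : Type*} [Field k] {V V' : Type*} [AddCommGroup V] [Module k V] [AddCommGroup V']
  [Module k V']

-- adapted from sidea-stub_port-1/StubPortHelpersAtTwo.lean (H1)
/-- **E1 (replaces KOLY 5.7.B / `exists_mem_pairingCoeff_ne_zero` at `2`; characteristic-free).**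
Polarise ONE LEVEL HIGHER: with the `T²`-coefficients `(Tx)₂ = x₁`, `(Dy)₂ = y₀ − y₁`
(`D = (1+T)⁻¹ − 1 = −T + T² − …`), a `(T, D)`-stable submodule `M` whose two slot-`0` projections are
onto has a member whose Gorenstein pairing has `T`-valuation `≤ 2`.  Proof: if `c₀, c₁, c₂`
vanish on `M`, polarise (`C_n(z, z') = 0`) and substitute `z' ↦ (Tx', Dy')`: `C₀, C₁` give
`2·ev(y'₀, x₀) = 0`, and `C₁(z, z') − C₂(z, γz') = 2(…) − ev(y'₀, x₀)`, so `ev(y'₀, x₀) = 0` in EVERY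
characteristic; the projections onto then force `ev = 0`. [folklore] -/
theorem exists_mem_pairingCoeff_le_two_ne_zero {e : ℕ} (he : 3 ≤ e)
    (ev : V' →ₗ[k] V →ₗ[k] k) (hev : ∃ (y : V') (v : V), ev y v ≠ 0)
    (T : (Fin e → V) →ₗ[k] (Fin e → V)) (D : (Fin e → V') →ₗ[k] (Fin e → V'))
    (hT0 : ∀ x, T x ⟨0, by omega⟩ = 0) (hT1 : ∀ x, T x ⟨1, by omega⟩ = x ⟨0, by omega⟩)
    (hT2 : ∀ x, T x ⟨2, by omega⟩ = x ⟨1, by omega⟩)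
    (hD0 : ∀ y, D y ⟨0, by omega⟩ = 0) (hD1 : ∀ y, D y ⟨1, by omega⟩ = -y ⟨0, by omega⟩)
    (hD2 : ∀ y, D y ⟨2, by omega⟩ = y ⟨0, by omega⟩ - y ⟨1, by omega⟩)
    (M : Submodule k ((Fin e → V) × (Fin e → V')))
    (hM : ∀ z ∈ M, (T z.1, D z.2) ∈ M)
    (h1 : ∀ v : V, ∃ z ∈ M, z.1 ⟨0, by omega⟩ = v)
    (h2' : ∀ y : V', ∃ z ∈ M, z.2 ⟨0, by omega⟩ = y) :
    ∃ z ∈ M, ev (z.2 ⟨0, by omega⟩) (z.1 ⟨0, by omega⟩) ≠ 0 ∨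
      ev (z.2 ⟨0, by omega⟩) (z.1 ⟨1, by omega⟩) + ev (z.2 ⟨1, by omega⟩) (z.1 ⟨0, by omega⟩) ≠ 0 ∨
      ev (z.2 ⟨0, by omega⟩) (z.1 ⟨2, by omega⟩) + ev (z.2 ⟨1, by omega⟩) (z.1 ⟨1, by omega⟩) +
        ev (z.2 ⟨2, by omega⟩) (z.1 ⟨0, by omega⟩) ≠ 0 := by
  by_contra hcon
  push Not at hcon
  -- KEY: `ev (y'₀, x₀) = 0` for all `z = (x,y)`, `z' = (x',y')` in `M`
  have key : ∀ z ∈ M, ∀ z' ∈ M, ev (z'.2 ⟨0, by omega⟩) (z.1 ⟨0, by omega⟩) = 0 := by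
    intro z hz z' hz'
    have hw : ((T z'.1, D z'.2) : (Fin e → V) × (Fin e → V')) ∈ M := hM z' hz'
    obtain ⟨h0z, h1z, h2z⟩ := hcon z hz
    obtain ⟨h0z', h1z', h2z'⟩ := hcon z' hz'
    obtain ⟨h0w, h1w, h2w⟩ := hcon _ hw
    obtain ⟨h0s, h1s, h2s⟩ := hcon (z + z') (M.add_mem hz hz')
    obtain ⟨h0t, h1t, h2t⟩ := hcon (z + (T z'.1, D z'.2)) (M.add_mem hz hw)
    simp only [Prod.fst_add, Prod.snd_add, Pi.add_apply, map_add, LinearMap.add_apply, hT0, hT1, hT2,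
      hD0, hD1, hD2, map_zero, LinearMap.zero_apply, map_neg, LinearMap.neg_apply, map_sub,
      LinearMap.sub_apply, add_zero, zero_add] at h0s h1s h2s h0t h1t h2t h0w h1w h2w
    -- (1)  s + a = 0,  (2′) s − a = 0,  (2) c + b₁ + d + b₂ = 0,  (B) c + d − b₁ + a − b₂ = 0
    have e1 : ev (z.2 ⟨0, by omega⟩) (z'.1 ⟨0, by omega⟩) + ev (z'.2 ⟨0, by omega⟩) (z.1 ⟨0, by omega⟩)
        = 0 := by linear_combination h0s - h0z - h0z'
    have e2' : ev (z.2 ⟨0, by omega⟩) (z'.1 ⟨0, by omega⟩) - ev (z'.2 ⟨0, by omega⟩) (z.1 ⟨0, by omega⟩)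
        = 0 := by linear_combination h1t - h1z
    have e2 : ev (z.2 ⟨0, by omega⟩) (z'.1 ⟨1, by omega⟩) + ev (z'.2 ⟨0, by omega⟩) (z.1 ⟨1, by omega⟩)
        + ev (z.2 ⟨1, by omega⟩) (z'.1 ⟨0, by omega⟩) + ev (z'.2 ⟨1, by omega⟩) (z.1 ⟨0, by omega⟩)
        = 0 := by linear_combination h1s - h1z - h1z'
    have eB : ev (z.2 ⟨0, by omega⟩) (z'.1 ⟨1, by omega⟩) + ev (z.2 ⟨1, by omega⟩) (z'.1 ⟨0, by omega⟩)
        - ev (z'.2 ⟨0, by omega⟩) (z.1 ⟨1, by omega⟩) + ev (z'.2 ⟨0, by omega⟩) (z.1 ⟨0, by omega⟩)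
        - ev (z'.2 ⟨1, by omega⟩) (z.1 ⟨0, by omega⟩) = 0 := by linear_combination h2t - h2z - h2w
    by_cases h2k : (2 : k) = 0
    · linear_combination eB - e2 +
        (ev (z'.2 ⟨0, by omega⟩) (z.1 ⟨1, by omega⟩) + ev (z'.2 ⟨1, by omega⟩) (z.1 ⟨0, by omega⟩)) * h2k
    · have h2a : (2 : k) * ev (z'.2 ⟨0, by omega⟩) (z.1 ⟨0, by omega⟩) = 0 := by
        linear_combination e1 - e2'
      exact (mul_eq_zero.mp h2a).resolve_left h2k
  -- the projections onto force `ev = 0`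
  obtain ⟨y, v, hyv⟩ := hev
  obtain ⟨z, hz, hzv⟩ := h1 v
  obtain ⟨z', hz', hz'y⟩ := h2' y
  exact hyv (by rw [← hzv, ← hz'y]; exact key z hz z' hz')

end LevelE

/-! ## E2  The cubic joint-value engine (replaces the central scalar) -/

namespace JointValue

universe u v

variable {R : Type u} [Ring R] [TopologicalSpace R]
variable {G : Type v} [Group G] [TopologicalSpace G]
variable {X Y : TopRep.{v} R G}

-- adapted from sidea-stub_port-1/StubPortHelpersAtTwo.lean (H2)
/-- **E2 (the CUBIC engine; replaces the central-scalar engine `exists_mem_map_eq_one_apply_eq` at `2`).**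
`H ⊴ G` acts trivially on `X`, `Y`; `z ∈ G` is central under `χ` and satisfies `z (z − 1) = 1` on `X`
and `Y` (a `3`-cycle of `GL₂(𝔽₂)` on `E[2] ⊗ R`: `z² + z + 1 = 0`).  Then every joint value
`w ∈ (φ, ψ)(H)` is the joint value of some `ν ∈ H` with `χ ν = 1`, namely
`ν = z (z τ z⁻¹ τ⁻¹) z⁻¹`: `φ ν = z•(z•φτ − φτ) = φτ`. [cite: SerreLocalFields1979, VII §5 Prop. 3] -/
theorem exists_mem_map_eq_one_apply_eq_of_cubic (φ : contOneCocycles X) (ψ : contOneCocycles Y)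
    (H : Subgroup G) [H.Normal] (hX : ∀ τ ∈ H, ∀ x : X, X.ρ τ x = x)
    (hY : ∀ τ ∈ H, ∀ y : Y, Y.ρ τ y = y) {B : Type*} [Group B] {Fχ : Type*} [FunLike Fχ G B]
    [MonoidHomClass Fχ G B] (χ : Fχ) {z : G} (hz : ∀ g : G, χ z * χ g = χ g * χ z)
    (hzX : ∀ x : X, X.ρ z (X.ρ z x - x) = x) (hzY : ∀ y : Y, Y.ρ z (Y.ρ z y - y) = y) {w : X × Y}
    (hw : w ∈ contOneCocycles.jointValueSubgroup φ ψ H hX hY) :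
    ∃ ν ∈ H, χ ν = 1 ∧ φ.1 ν = w.1 ∧ ψ.1 ν = w.2 := by
  obtain ⟨τ, hτ, rfl⟩ := hw
  obtain ⟨hc, hφc⟩ := apply_comm_of_fixed φ H hX z hτ
  obtain ⟨-, hψc⟩ := apply_comm_of_fixed ψ H hY z hτ
  have hν : z * (z * τ * z⁻¹ * τ⁻¹) * z⁻¹ ∈ H := Subgroup.Normal.conj_mem inferInstance _ hc z
  refine ⟨z * (z * τ * z⁻¹ * τ⁻¹) * z⁻¹, hν, ?_, ?_, ?_⟩
  · rw [map_mul, map_mul, map_comm_eq_one χ hz τ, mul_one, ← map_mul, mul_inv_cancel, map_one]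
  · rw [contOneCocycles.apply_conj_of_fixed φ (hX _ hc), hφc, hzX]
  · rw [contOneCocycles.apply_conj_of_fixed ψ (hY _ hc), hψc, hzY]

-- adapted from sidea-stub_port-1/StubPortHelpersAtTwo.lean (H2′)
/-- E2′: joint values with prescribed `χ`-value, cubic form (as `exists_mem_map_eq_apply_eq`): every joint
value `w ∈ (φ, ψ)(H)` is `(φ σ, ψ σ)` for some `σ ∈ H` with `χ σ = χ σ₁`, `σ₁ ∈ H` prescribed.
[cite: SerreLocalFields1979, VII §5 Prop. 3] -/
theorem exists_mem_map_eq_apply_eq_of_cubic (φ : contOneCocycles X) (ψ : contOneCocycles Y)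
    (H : Subgroup G) [H.Normal] (hX : ∀ τ ∈ H, ∀ x : X, X.ρ τ x = x)
    (hY : ∀ τ ∈ H, ∀ y : Y, Y.ρ τ y = y) {B : Type*} [Group B] {Fχ : Type*} [FunLike Fχ G B]
    [MonoidHomClass Fχ G B] (χ : Fχ) {z : G} (hz : ∀ g : G, χ z * χ g = χ g * χ z)
    (hzX : ∀ x : X, X.ρ z (X.ρ z x - x) = x) (hzY : ∀ y : Y, Y.ρ z (Y.ρ z y - y) = y) {σ₁ : G}
    (hσ₁ : σ₁ ∈ H) {w : X × Y} (hw : w ∈ contOneCocycles.jointValueSubgroup φ ψ H hX hY) :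
    ∃ σ ∈ H, χ σ = χ σ₁ ∧ φ.1 σ = w.1 ∧ ψ.1 σ = w.2 := by
  have hw₁ : ((φ.1 σ₁, ψ.1 σ₁) : X × Y) ∈ contOneCocycles.jointValueSubgroup φ ψ H hX hY :=
    ⟨σ₁, hσ₁, rfl⟩
  obtain ⟨ν, hν, hχν, hφν, hψν⟩ := exists_mem_map_eq_one_apply_eq_of_cubic φ ψ H hX hY χ hz hzX hzY
    (AddSubgroup.sub_mem _ hw hw₁)
  refine ⟨ν * σ₁, H.mul_mem hν hσ₁, ?_, ?_, ?_⟩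
  · rw [map_mul, hχν, one_mul]
  · rw [contOneCocycles.apply_mul_of_fixed φ (hX ν hν), hφν, Prod.fst_sub, sub_add_cancel]
  · rw [contOneCocycles.apply_mul_of_fixed ψ (hY ν hν), hψν, Prod.snd_sub, sub_add_cancel]

end JointValue

/-! ## H3–H5  Arithmetic at `p = 2` -/

namespace AtTwo

-- adapted from sidea-stub_port-1/StubPortHelpersAtTwo.lean (H3)
/-- **H3 (Klein rigidity for a `3`-cycle).** On the Klein four-group a fixed-point-free `z` satisfies
`z (z m − m) = m` (`z³ = 1`, `m + z m + z² m` is `z`-fixed hence `0`). Feeds `hzX` / `hzY` of E2 via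
`TowerImage.exists_fpf_mem_kerSubgroup_of_irreducible`. [cite: Serre1972, §5.3] -/
theorem smul_smul_sub_eq_self_of_fpf {Q : Type*} [Group Q] {M : Type*} [AddCommGroup M]
    [DistribMulAction Q M] (h4 : Nat.card M = 4) (h2 : ∀ m : M, m + m = 0) {z : Q}
    (hz : ∀ m : M, z • m = m → m = 0) (m : M) : z • (z • m - m) = m := by
  rw [smul_sub,
    Summit.BirchSwinnertonDyer.BirchSwinnertonDyer.Theorems.AlignedTransportAtTwoFineRoad.PerfectDescent.smul_smul_eq_add_of_fpf
      h4 h2 hz m,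
    add_sub_cancel_right]

/-- **H4, every prime (unipotent ⟹ nilpotent on a `p`-torsion group, no `p ≠ 2`).** On an additive group
killed by the prime `p`, an additive `g` with `g^{[pⁿ]} = id` has `(g − id)^{[pⁿ]} = 0`: in the ring
`End(V)`, `g^{pⁿ} = ((g − 1) + 1)^{pⁿ} = (g − 1)^{pⁿ} + 1 + p (g − 1) r` (`Commute.exists_add_pow_prime_pow_eq`)
and `p = 0` on `V`. The `p = 2` twin-without-hypothesis of `SelmerDual.iterate_conj_sub_id_eq_zero_of_pow`.
[folklore] -/
theorem iterate_sub_id_eq_zero_of_prime_pow {V : Type*} [AddCommGroup V] {p : ℕ} [hp : Fact p.Prime]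
    (hV : ∀ v : V, p • v = 0) (g : V →+ V) {n : ℕ} (hg : ∀ v, g^[p ^ n] v = v) (v : V) :
    (⇑(g - AddMonoidHom.id V))^[p ^ n] v = 0 := by
  -- in the ring `AddMonoid.End V`
  let G : AddMonoid.End V := g
  obtain ⟨r, hr⟩ := Commute.exists_add_pow_prime_pow_eq hp.out (Commute.one_right (G - 1)) n
  rw [sub_add_cancel, one_pow, mul_one] at hr
  -- `hr : G ^ p ^ n = (G - 1) ^ p ^ n + 1 + p * (G - 1) * r`
  have hpow : ∀ (X : AddMonoid.End V) (k : ℕ) (w : V), (X ^ k) w = (⇑X)^[k] w := fun X k w => by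
    rw [AddMonoid.End.coe_pow]
  have hfun : ⇑(g - AddMonoidHom.id V) = ⇑(G - 1) := rfl
  have hGv : (G ^ p ^ n) v = v := by rw [hpow]; exact hg v
  have hpr : ((p : AddMonoid.End V) * (G - 1) * r) v = 0 := by
    rw [mul_assoc, AddMonoid.End.coe_mul, Function.comp_apply, AddMonoid.End.natCast_apply, hV]
  have key : ((G - 1) ^ p ^ n) v + v + ((p : AddMonoid.End V) * (G - 1) * r) v = v := by
    have h := congrArg (fun X : AddMonoid.End V => X v) hr
    rw [hGv] at h
    -- `(A + 1 + C) v = A v + v + C v` definitionally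
    exact h.symm
  rw [hpr, add_zero, add_eq_right] at key
  rw [hfun, ← hpow, key]

/-- **H4 (the `hG1` arithmetic at `2`; replaces `SelmerDual.iterate_conj_sub_id_eq_zero_of_pow hp2`).**
On a `2`-torsion group, `g^{2ⁿ} = 1 ⟹ (g − 1)^{2ⁿ} = g^{2ⁿ} − 1 = 0` (Frobenius in characteristic `2`);
the case `p = 2` of `iterate_sub_id_eq_zero_of_prime_pow`. [folklore] -/
theorem iterate_sub_id_eq_zero_of_pow_two {V : Type*} [AddCommGroup V] (hV : ∀ v : V, 2 • v = 0)
    (g : V →+ V) {n : ℕ} (hg : ∀ v, g^[2 ^ n] v = v) (v : V) :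
    (⇑(g - AddMonoidHom.id V))^[2 ^ n] v = 0 :=
  iterate_sub_id_eq_zero_of_prime_pow (p := 2) hV g hg v

/-- Gauss: `Σ_{i < 4k} i = 2 · (k (4k − 1))` is even. [folklore] -/
theorem sum_range_four_mul_eq (k : ℕ) : ∑ i ∈ range (4 * k), i = 2 * (k * (4 * k - 1)) := by
  have h := Finset.sum_range_id_mul_two (4 * k)
  generalize 4 * k - 1 = m at h
  have h' : (∑ i ∈ range (4 * k), i) * 2 = 2 * (k * m) * 2 := by rw [h]; ring
  exact Nat.eq_of_mul_eq_mul_right two_pos h'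

/-- **H5 (the binomial site `C(ℓ − 1, 2) · t = 0` at `2`; replaces `sum_range_natCast_zsmul_eq_zero hp2`):**
`Σ_{i<n} i = n (n − 1) / 2` kills a `2`-torsion module as soon as `4 ∣ n` — so the Kolyvagin prime must
have `ℓ ≡ 1 (mod 4)`. [cite: Rubin2000, §4.4 (4.9) and Lemma 4.4.2] -/
theorem sum_range_natCast_zsmul_eq_zero_of_four_dvd {M : Type*} [AddCommGroup M]
    (hM : ∀ m : M, 2 • m = 0) {J n : ℕ} (hn : 4 ∣ n) (x : Fin J → M) :
    (∑ i ∈ range n, (i : ℤ)) • x = 0 := by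
  have h1 : (∑ i ∈ range n, (i : ℤ)) • x = (∑ i ∈ range n, i) • x := by
    rw [← Nat.cast_sum, natCast_zsmul]
  rw [h1]
  obtain ⟨k, rfl⟩ := hn
  rw [sum_range_four_mul_eq, mul_smul]
  funext i
  rw [Pi.smul_apply, Pi.zero_apply, hM]

end AtTwo

end Summit.BirchSwinnertonDyer.BirchSwinnertonDyer.Rank1Residual

end
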